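import Summits.ResolutionOfSingularities.ResolutionOfSingularities.Theorems.FrobeniusClosingSteerHatConePersistence
import Summits.ResolutionOfSingularities.ResolutionOfSingularities.Theorems.FrobeniusClosingSteerBetaHatStageWords
import HarnessLib

/-!
# Crux `Steer` (stmt-ResolutionOfSingularities-16345), chain W4.1 — the β-slot `ConePersistenceX` DISCHARGED at word level:
# `conePersistenceX_of_words`, and its y-chart twin `conePersistenceY_of_words`

OURS (campaign `res-hironaka`, rung L ★L-G4, slot W4.1; seat res-L0-w41-stub-4 g7 on res-L0-w41-plan-1 RULING 207(a) «`conePersistenceX_holds`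
is YOURS»). Replaces the role of no printed item; NOT a statement of the manuscript under review [claim: Hironaka2017, status: under-review];
AI-produced, weaker than expert review. Theses-free, definition-free. Words: the tree's `IsHatRing` / `IsXChartHat` (`…BetaHatStageWords`, p552756).

* `conePersistenceX_of_words` — binder for binder the body of idea-1's word `ConePersistenceX` (β-leaf successor
  `Sketch-idea-1-v18-hatleaf.v184-J4K7SHCP.lean` 638f2c3836e9ecc5 l.447; res-L0-w41-tri-2 ONE-HUNK PASS 18:09:41Z): along an x-chart letter
  `S → S₁` of hat rings in section form, with square-free twists and the radicand relation, for degree-`d` forms `Ψ, Ψ₁` carrying the stage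
  congruences of `f, f₁` with nonzero residue forms, `Ψ̄₁ = μ · (Ψ̄ ⊗_ī κ₁)` for a nonzero `μ ∈ κ₁`. Proof = `conePersistence_core`
  (`…HatConePersistence`, words-free) with `p := 2` and the hat-ring / chart data unbundled from the words. So the leaf's
  `conePersistenceX_holds : ConePersistenceX` is `fun S S₁ … => conePersistenceX_of_words …` (same binder order).
* `conePersistenceY_of_words` — the same for idea-1's `ConePersistenceY` (y-chart: `IsYChartHat`, frame `(x₁, φ y, z₁, w₁)`, relation
  `φ (u f) = φ y^(2k)·u₁ f₁`, cone ideal `(x₁, φ y)·𝔪₁^(d−1) + 𝔪₁^(d+1)`): the y-chart of `(x,y,z,w)` IS the x-chart of the swapped frame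
  `(y,x,z,w)` at the rational point `c = 0` with `v₁ := x₁`, so the same core applies with the twist exponents swapped.
As the core shows, `Odd d`, `IsHatRing S`, `CharP S 2`, `a ≤ 1`, `a₁, b₁ ≤ 1` are NOT used (`3 ≤ d` only as `1 ≤ d`); they are carried for the word.

[cite: CossartJannsenSaito2020, Lemma 12.1 (2)] [folklore]
bears_on: LADDER-RESOLUTION L ★L-G4 W4.1 (crux `Steer`, binder hK4ⁿᶜ, β-slot `ConePersistenceX`, K-β0(b) `arithTransport_of`).
-/

noncomputable section

-- `Summit.<S>.<S>.…` duplicates the summit name by design (single-problem summit).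
set_option linter.dupNamespace false

open IsLocalRing
open Summit.ResolutionOfSingularities.ResolutionOfSingularities.Theorems.SwitchingDichotomy.BetaPolygon

namespace Summit.ResolutionOfSingularities.ResolutionOfSingularities.Theorems.SwitchingDichotomy.HatBaseChange

/-- **`ConePersistenceX` at word level.** See the module docstring. -/
theorem conePersistenceX_of_words (S S₁ : Type) [CommRing S] [IsLocalRing S] [CharP S 2] [CommRing S₁] [IsLocalRing S₁] [CharP S₁ 2]
    (φ : S →+* S₁) (σ : ResidueField S →+* S) (σ₁ : ResidueField S₁ →+* S₁)
    (x y z w u f : S) (c : ResidueField S₁) (v₁ z₁ w₁ u₁ f₁ : S₁) (d k : ℕ)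
    (Ψ : MvPolynomial (Fin 2) S) (Ψ₁ : MvPolynomial (Fin 2) S₁)
    (_hS : IsHatRing S) (hS₁ : IsHatRing S₁) (_hodd : Odd d) (h3 : 3 ≤ d)
    (hspan : Ideal.span {x, y, z, w} = maximalIdeal S) (hu : ∃ a b : ℕ, a ≤ 1 ∧ b ≤ 1 ∧ u = x ^ a * y ^ b)
    (hX : IsXChartHat φ σ σ₁ x y z w c v₁ z₁ w₁)
    (hrel : φ (u * f) = φ x ^ (2 * k) * (u₁ * f₁)) (hu₁ : ∃ a b : ℕ, a ≤ 1 ∧ b ≤ 1 ∧ u₁ = φ x ^ a * v₁ ^ b)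
    (hΨ : Ψ.IsHomogeneous d)
    (hcong : f - MvPolynomial.eval ![z, w] Ψ ∈ Ideal.span {x, y} * maximalIdeal S ^ (d - 1) ⊔ maximalIdeal S ^ (d + 1))
    (hΨ0 : MvPolynomial.map (residue S) Ψ ≠ 0)
    (hΨ₁ : Ψ₁.IsHomogeneous d)
    (hcong₁ : f₁ - MvPolynomial.eval ![z₁, w₁] Ψ₁ ∈ Ideal.span {φ x, v₁} * maximalIdeal S₁ ^ (d - 1) ⊔ maximalIdeal S₁ ^ (d + 1))
    (hΨ₁0 : MvPolynomial.map (residue S₁) Ψ₁ ≠ 0) :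
    ∃ μ : ResidueField S₁, μ ≠ 0 ∧
      MvPolynomial.map (residue S₁) Ψ₁ =
        MvPolynomial.C μ * MvPolynomial.map (((residue S₁).comp (φ.comp σ)).comp (residue S)) Ψ := by
  obtain ⟨_, hreg₁, hcomp₁, hdim₁, hperf₁⟩ := hS₁
  haveI := hcomp₁; haveI := hperf₁
  obtain ⟨hσ, hσ₁, hcompat, -, hspan₁, hy, hz, hw⟩ := hX
  obtain ⟨a, b, -, hb, hu⟩ := hu
  obtain ⟨a₁, b₁, -, -, hu₁⟩ := hu₁
  exact conePersistence_core 2 Nat.prime_two hreg₁ hdim₁ φ σ σ₁ hσ hσ₁ hcompat x y z w u f c v₁ z₁ w₁ u₁ f₁ hspan hspan₁ hy hz hw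
    a b a₁ b₁ k d hb (by omega) hu hu₁ hrel Ψ hΨ hcong hΨ0 Ψ₁ hΨ₁ hcong₁ hΨ₁0

/-- **`ConePersistenceY` at word level** (the y-chart twin, β-leaf `…v184-J4K7SHCPTK.lean` f234d5a42107163a l.≈472, binder for binder):
the y-chart of `(x, y, z, w)` is the x-chart of the SWAPPED frame `(y, x, z, w)` at the RATIONAL point `c = 0` with `v₁ := x₁`
(`φ x = φ y · (σ₁ 0 + x₁)`), so `conePersistence_core` applies verbatim with the twist exponents swapped. -/
theorem conePersistenceY_of_words (S S₁ : Type) [CommRing S] [IsLocalRing S] [CharP S 2] [CommRing S₁] [IsLocalRing S₁] [CharP S₁ 2]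
    (φ : S →+* S₁) (σ : ResidueField S →+* S) (σ₁ : ResidueField S₁ →+* S₁)
    (x y z w u f : S) (x₁ z₁ w₁ u₁ f₁ : S₁) (d k : ℕ)
    (Ψ : MvPolynomial (Fin 2) S) (Ψ₁ : MvPolynomial (Fin 2) S₁)
    (_hS : IsHatRing S) (hS₁ : IsHatRing S₁) (_hodd : Odd d) (h3 : 3 ≤ d)
    (hspan : Ideal.span {x, y, z, w} = maximalIdeal S) (hu : ∃ a b : ℕ, a ≤ 1 ∧ b ≤ 1 ∧ u = x ^ a * y ^ b)
    (hY : IsYChartHat φ σ σ₁ x y z w x₁ z₁ w₁)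
    (hrel : φ (u * f) = φ y ^ (2 * k) * (u₁ * f₁)) (hu₁ : ∃ a b : ℕ, a ≤ 1 ∧ b ≤ 1 ∧ u₁ = x₁ ^ a * φ y ^ b)
    (hΨ : Ψ.IsHomogeneous d)
    (hcong : f - MvPolynomial.eval ![z, w] Ψ ∈ Ideal.span {x, y} * maximalIdeal S ^ (d - 1) ⊔ maximalIdeal S ^ (d + 1))
    (hΨ0 : MvPolynomial.map (residue S) Ψ ≠ 0)
    (hΨ₁ : Ψ₁.IsHomogeneous d)
    (hcong₁ : f₁ - MvPolynomial.eval ![z₁, w₁] Ψ₁ ∈ Ideal.span {x₁, φ y} * maximalIdeal S₁ ^ (d - 1) ⊔ maximalIdeal S₁ ^ (d + 1))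
    (hΨ₁0 : MvPolynomial.map (residue S₁) Ψ₁ ≠ 0) :
    ∃ μ : ResidueField S₁, μ ≠ 0 ∧
      MvPolynomial.map (residue S₁) Ψ₁ =
        MvPolynomial.C μ * MvPolynomial.map (((residue S₁).comp (φ.comp σ)).comp (residue S)) Ψ := by
  obtain ⟨_, hreg₁, hcomp₁, hdim₁, hperf₁⟩ := hS₁
  haveI := hcomp₁; haveI := hperf₁
  obtain ⟨hσ, hσ₁, hcompat, -, hspan₁, hx, hz, hw⟩ := hY
  obtain ⟨a, b, ha, -, hu⟩ := hu
  obtain ⟨a₁, b₁, -, -, hu₁⟩ := hu₁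
  -- swap the frame: `(x', y') := (y, x)`, chart point `c = 0`, `v₁ := x₁`
  have hspan' : Ideal.span {y, x, z, w} = maximalIdeal S := by rw [← hspan, Set.insert_comm]
  have hspan₁' : Ideal.span {φ y, x₁, z₁, w₁} = maximalIdeal S₁ := by rw [← hspan₁, Set.insert_comm]
  have hx' : φ x = φ y * (σ₁ 0 + x₁) := by rw [map_zero, zero_add, hx]
  have hu' : u = y ^ b * x ^ a := by rw [hu, mul_comm]
  have hu₁' : u₁ = φ y ^ b₁ * x₁ ^ a₁ := by rw [hu₁, mul_comm]
  have hcong' : f - MvPolynomial.eval ![z, w] Ψ ∈ Ideal.span {y, x} * maximalIdeal S ^ (d - 1) ⊔ maximalIdeal S ^ (d + 1) := by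
    rwa [Set.pair_comm]
  have hcong₁' : f₁ - MvPolynomial.eval ![z₁, w₁] Ψ₁ ∈
      Ideal.span {φ y, x₁} * maximalIdeal S₁ ^ (d - 1) ⊔ maximalIdeal S₁ ^ (d + 1) := by
    rwa [Set.pair_comm]
  exact conePersistence_core 2 Nat.prime_two hreg₁ hdim₁ φ σ σ₁ hσ hσ₁ hcompat y x z w u f 0 x₁ z₁ w₁ u₁ f₁ hspan' hspan₁' hx' hz hw
    b a b₁ a₁ k d ha (by omega) hu' hu₁' hrel Ψ hΨ hcong' hΨ0 Ψ₁ hΨ₁ hcong₁' hΨ₁0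

end Summit.ResolutionOfSingularities.ResolutionOfSingularities.Theorems.SwitchingDichotomy.HatBaseChange

end
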